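import Mathlib
import HarnessLib

/-!
# LINE «tauber» on crux ⟨stmt-QuantumFields-24204⟩ `VirialFluxGap.SharpTwistedLaplace` (planner ym-idea-4 g14, skeleton
# `bc/g14-A/split/SharpTwistedLaplace_birth.lean`, critic idea-crit-4 g8 PASS 2026-08-29T07:33Z): the stub `stub_windowArithmetic` BY NAME

The pure window arithmetic of the line: on Laplace windows `L ≤ β^a` with `a = 1/(4(q₁+10))` the three thresholds of the Tauberian
transfer (`β ≥ 2`, `β ≥ 2(κ(N+1)+1)`, `64(N+2)²(1+|log v|+|log t₀|+log β) ≤ β t₀` with `N = 9L⁴`, `κ = t₀⁻¹ = K₁L^{q₁}`, `|log v| ≤ K₁L^{q₁}`)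
hold eventually in `β`, and the error packs as `(4K₁L^{q₁}(9L⁴+1)+4)/β ≤ (40K₁+8)L^{q₁+4}/β`.  Elementary: `9L⁴+2 ≤ 11L⁴`,
`|log(K₁L^{q₁})| ≤ |log K₁| + q₁L`, `log β ≤ β^a/a`, every monomial `L^r β^{s}` with `a r + s ≤ 1/2` is `≤ β^{1/2}`, and `C β^{1/2} ≤ β` once
`β ≥ C²`.  The Prop `WindowArithmetic` is restated CHARACTER-IDENTICALLY from the skeleton (namespace of this file).

Mathlib only; no `sorry`; standard axioms.  HONEST LABEL: an S/M helper of a DRAFT-by-design second line (idle-hand permission, director-ym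
desk word #2 2026-08-29T07:52Z); the heart `stub_volumeExponent`, the crux 24204, the route and every summit statement are untouched; the
Yang–Mills mass gap is NOT proved.  Width seat `ym-line-sfw-p2-w3` g36 (cell ym-idea-1, free hands), `--supports stmt-QuantumFields-24204`.
-/

set_option autoImplicit false

noncomputable section

namespace Summit.QuantumFields.YangMills.Theorems.VirialFluxGapSharpTwistedLaplaceWindow

/-- Statement of `stub_windowArithmetic` (pure asymptotics on Laplace windows) — verbatim from the skeleton
`SharpTwistedLaplace_birth.lean` (LINE «tauber», ym-idea-4 g14). [problem-side definition] -/
def WindowArithmetic : Prop :=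
  ∀ K₁ q₁ : ℝ, 0 < K₁ → 0 ≤ q₁ → ∃ a : ℝ, 0 < a ∧ ∃ β₀ : ℝ, ∀ β : ℝ, β₀ ≤ β → ∀ L : ℕ, 1 ≤ L → (L : ℝ) ≤ β ^ a →
    ∀ w : ℝ, |w| ≤ K₁ * (L : ℝ) ^ q₁ →
      2 ≤ β ∧
      2 * (K₁ * (L : ℝ) ^ q₁ * (((9 * L ^ 4 : ℕ) : ℝ) + 1) + 1) ≤ β ∧
      64 * (((9 * L ^ 4 : ℕ) : ℝ) + 2) ^ 2 * (1 + |w| + |Real.log ((K₁ * (L : ℝ) ^ q₁)⁻¹)| + Real.log β) ≤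
        β * (K₁ * (L : ℝ) ^ q₁)⁻¹ ∧
      (4 * (K₁ * (L : ℝ) ^ q₁) * (((9 * L ^ 4 : ℕ) : ℝ) + 1) + 4) / β ≤ (40 * K₁ + 8) * (L : ℝ) ^ (q₁ + 4) / β

/-- `c ≤ β^{1/2}` once `c² ≤ β` (`c ≥ 0`). -/
theorem le_rpow_half_of_sq_le {c β : ℝ} (hc : 0 ≤ c) (h : c ^ 2 ≤ β) : c ≤ β ^ (1 / 2 : ℝ) := by
  calc c = (c ^ 2) ^ (1 / 2 : ℝ) := by rw [← Real.sqrt_eq_rpow, Real.sqrt_sq hc]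
    _ ≤ β ^ (1 / 2 : ℝ) := Real.rpow_le_rpow (sq_nonneg _) h (by norm_num)

/-- ★ **`stub_windowArithmetic` BY NAME**: the window arithmetic of LINE «tauber» holds with `a = 1/(4(q₁+10))`. [folklore] -/
theorem stub_windowArithmetic : WindowArithmetic := by
  intro K₁ q₁ hK₁ hq₁
  -- the window exponent and the threshold
  obtain ⟨a, ha0, hadef⟩ : ∃ a : ℝ, 0 < a ∧ a = 1 / (4 * (q₁ + 10)) := ⟨_, by positivity, rfl⟩
  have ha1 : a * (2 * q₁ + 9) ≤ 1 / 2 := by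
    rw [hadef, div_mul_eq_mul_div, one_mul, div_le_iff₀ (by positivity)]; nlinarith
  have ha2 : a * (q₁ + 9) ≤ 1 / 2 := by
    rw [hadef, div_mul_eq_mul_div, one_mul, div_le_iff₀ (by positivity)]; nlinarith
  have ha3 : a * (q₁ + 4) ≤ 1 / 2 := by
    rw [hadef, div_mul_eq_mul_div, one_mul, div_le_iff₀ (by positivity)]; nlinarith
  set C₂ : ℝ := 20 * K₁ + 2 with hC₂
  set C₃ : ℝ := 7744 * K₁ * (1 + K₁ + |Real.log K₁| + q₁ + 1 / a) with hC₃
  have hC₂0 : 0 ≤ C₂ := by positivity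
  have hC₃0 : 0 ≤ C₃ := by positivity
  refine ⟨a, ha0, max 2 (max (C₂ ^ 2) (C₃ ^ 2)), ?_⟩
  intro β hβ L hL hLβ w hw
  have hβ2 : 2 ≤ β := le_trans (le_max_left _ _) hβ
  have hβC₂ : C₂ ^ 2 ≤ β := le_trans ((le_max_left _ _).trans (le_max_right _ _)) hβ
  have hβC₃ : C₃ ^ 2 ≤ β := le_trans ((le_max_right _ _).trans (le_max_right _ _)) hβ
  have hβ1 : 1 ≤ β := by linarith
  have hβ0 : 0 < β := by linarith
  have hℓ1 : (1 : ℝ) ≤ L := by exact_mod_cast hL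
  have hℓ0 : (0 : ℝ) < L := by linarith
  -- notation-free abbreviations
  have h9 : (((9 * L ^ 4 : ℕ) : ℝ)) = 9 * (L : ℝ) ^ 4 := by push_cast; ring
  have hP1 : 1 ≤ (L : ℝ) ^ 4 := one_le_pow₀ hℓ1
  have hR1 : 1 ≤ (L : ℝ) ^ q₁ := Real.one_le_rpow hℓ1 hq₁
  have hR0 : 0 < (L : ℝ) ^ q₁ := by positivity
  have hκ0 : 0 < K₁ * (L : ℝ) ^ q₁ := by positivity
  have hκ1 : K₁ ≤ K₁ * (L : ℝ) ^ q₁ := le_mul_of_one_le_right hK₁.le hR1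
  -- `β^{1/2}`
  have hH1 : 1 ≤ β ^ (1 / 2 : ℝ) := Real.one_le_rpow hβ1 (by norm_num)
  have hHH : β ^ (1 / 2 : ℝ) * β ^ (1 / 2 : ℝ) = β := by
    rw [← Real.rpow_add hβ0]; norm_num
  have hHC₂ : C₂ ≤ β ^ (1 / 2 : ℝ) := le_rpow_half_of_sq_le hC₂0 hβC₂
  have hHC₃ : C₃ ≤ β ^ (1 / 2 : ℝ) := le_rpow_half_of_sq_le hC₃0 hβC₃
  -- monomials in `L` are `≤ β^{1/2}`
  have hpow : ∀ r : ℝ, 0 ≤ r → a * r ≤ 1 / 2 → (L : ℝ) ^ r ≤ β ^ (1 / 2 : ℝ) := by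
    intro r hr har
    calc (L : ℝ) ^ r ≤ (β ^ a) ^ r := Real.rpow_le_rpow hℓ0.le hLβ hr
      _ = β ^ (a * r) := by rw [← Real.rpow_mul hβ0.le]
      _ ≤ β ^ (1 / 2 : ℝ) := Real.rpow_le_rpow_of_exponent_le hβ1 har
  -- rpow bookkeeping
  have hnat : ∀ n : ℕ, (L : ℝ) ^ (n : ℝ) = (L : ℝ) ^ n := fun n => Real.rpow_natCast _ n
  have hq4 : (L : ℝ) ^ (q₁ + 4) = (L : ℝ) ^ q₁ * (L : ℝ) ^ 4 := by
    rw [Real.rpow_add hℓ0, show (4 : ℝ) = ((4 : ℕ) : ℝ) by norm_num, hnat]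
  have hq8 : (L : ℝ) ^ (q₁ + 8) = (L : ℝ) ^ q₁ * ((L : ℝ) ^ 4 * (L : ℝ) ^ 4) := by
    rw [Real.rpow_add hℓ0, show (8 : ℝ) = ((8 : ℕ) : ℝ) by norm_num, hnat]; ring
  have hq1' : (L : ℝ) ^ (q₁ + 1) = (L : ℝ) ^ q₁ * (L : ℝ) := by
    rw [Real.rpow_add hℓ0, Real.rpow_one]
  have h2q9 : (L : ℝ) ^ (2 * q₁ + 9) = (L : ℝ) ^ (q₁ + 8) * (L : ℝ) ^ (q₁ + 1) := by
    rw [← Real.rpow_add hℓ0]; ring_nf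
  -- (4) packing of the error
  have hpack : 4 * (K₁ * (L : ℝ) ^ q₁) * (((9 * L ^ 4 : ℕ) : ℝ) + 1) + 4 ≤ (40 * K₁ + 8) * (L : ℝ) ^ (q₁ + 4) := by
    rw [h9, hq4]
    have h1 : 9 * (L : ℝ) ^ 4 + 1 ≤ 10 * (L : ℝ) ^ 4 := by linarith
    have h2 : 1 ≤ (L : ℝ) ^ q₁ * (L : ℝ) ^ 4 := one_le_mul_of_one_le_of_one_le hR1 hP1
    have h3 := mul_le_mul_of_nonneg_left h1 (by positivity : 0 ≤ 4 * (K₁ * (L : ℝ) ^ q₁))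
    have e1 : 4 * (K₁ * (L : ℝ) ^ q₁) * (10 * (L : ℝ) ^ 4) = 40 * K₁ * ((L : ℝ) ^ q₁ * (L : ℝ) ^ 4) := by ring
    have e2 : (40 * K₁ + 8) * ((L : ℝ) ^ q₁ * (L : ℝ) ^ 4) = 40 * K₁ * ((L : ℝ) ^ q₁ * (L : ℝ) ^ 4) + 8 * ((L : ℝ) ^ q₁ * (L : ℝ) ^ 4) := by
      ring
    rw [e2]
    linarith
  -- (2) the second threshold
  have hthr2 : 2 * (K₁ * (L : ℝ) ^ q₁ * (((9 * L ^ 4 : ℕ) : ℝ) + 1) + 1) ≤ β := by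
    rw [h9]
    have h1 : K₁ * (L : ℝ) ^ q₁ * (9 * (L : ℝ) ^ 4 + 1) ≤ 10 * K₁ * (L : ℝ) ^ (q₁ + 4) := by
      rw [hq4]
      have : 9 * (L : ℝ) ^ 4 + 1 ≤ 10 * (L : ℝ) ^ 4 := by linarith
      have h := mul_le_mul_of_nonneg_left this hκ0.le
      have e : K₁ * (L : ℝ) ^ q₁ * (10 * (L : ℝ) ^ 4) = 10 * K₁ * ((L : ℝ) ^ q₁ * (L : ℝ) ^ 4) := by ring
      linarith
    have h2 : (L : ℝ) ^ (q₁ + 4) ≤ β ^ (1 / 2 : ℝ) := hpow _ (by linarith) ha3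
    have h3 : 2 * (10 * K₁ * (L : ℝ) ^ (q₁ + 4) + 1) ≤ C₂ * β ^ (1 / 2 : ℝ) := by
      have h := mul_le_mul_of_nonneg_left h2 (by positivity : 0 ≤ 20 * K₁)
      have e : C₂ * β ^ (1 / 2 : ℝ) = 20 * K₁ * β ^ (1 / 2 : ℝ) + 2 * β ^ (1 / 2 : ℝ) := by rw [hC₂]; ring
      rw [e]
      linarith
    calc 2 * (K₁ * (L : ℝ) ^ q₁ * (9 * (L : ℝ) ^ 4 + 1) + 1) ≤ 2 * (10 * K₁ * (L : ℝ) ^ (q₁ + 4) + 1) := by linarith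
      _ ≤ C₂ * β ^ (1 / 2 : ℝ) := h3
      _ ≤ β ^ (1 / 2 : ℝ) * β ^ (1 / 2 : ℝ) := mul_le_mul_of_nonneg_right hHC₂ (by positivity)
      _ = β := hHH
  -- (3) the Gamma/Poisson threshold
  have hthr3 : 64 * (((9 * L ^ 4 : ℕ) : ℝ) + 2) ^ 2 * (1 + |w| + |Real.log ((K₁ * (L : ℝ) ^ q₁)⁻¹)| + Real.log β) ≤
      β * (K₁ * (L : ℝ) ^ q₁)⁻¹ := by
    rw [le_mul_inv_iff₀ hκ0, h9]
    -- the logarithms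
    have hlogκ : |Real.log ((K₁ * (L : ℝ) ^ q₁)⁻¹)| ≤ |Real.log K₁| + q₁ * (L : ℝ) := by
      rw [Real.log_inv, abs_neg, Real.log_mul hK₁.ne' hR0.ne', Real.log_rpow hℓ0]
      refine (abs_add_le _ _).trans (add_le_add le_rfl ?_)
      rw [abs_of_nonneg (mul_nonneg hq₁ (Real.log_nonneg hℓ1))]
      exact mul_le_mul_of_nonneg_left ((Real.log_le_sub_one_of_pos hℓ0).trans (by linarith)) hq₁
    have hlogβ : Real.log β ≤ β ^ a / a := Real.log_le_rpow_div hβ0.le ha0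
    -- the sum `S`
    have hS : 1 + |w| + |Real.log ((K₁ * (L : ℝ) ^ q₁)⁻¹)| + Real.log β ≤
        (1 + K₁ + |Real.log K₁| + q₁) * (L : ℝ) ^ (q₁ + 1) + β ^ a / a := by
      have h1 : 1 ≤ (L : ℝ) ^ (q₁ + 1) := Real.one_le_rpow hℓ1 (by linarith)
      have h2 : (L : ℝ) ^ q₁ ≤ (L : ℝ) ^ (q₁ + 1) := Real.rpow_le_rpow_of_exponent_le hℓ1 (by linarith)
      have h3 : (L : ℝ) ≤ (L : ℝ) ^ (q₁ + 1) := by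
        calc (L : ℝ) = (L : ℝ) ^ (1 : ℝ) := (Real.rpow_one _).symm
          _ ≤ (L : ℝ) ^ (q₁ + 1) := Real.rpow_le_rpow_of_exponent_le hℓ1 (by linarith)
      have habs : 0 ≤ |Real.log K₁| := abs_nonneg _
      have f1 := mul_le_mul_of_nonneg_left h2 hK₁.le
      have f2 := mul_le_mul_of_nonneg_left h3 hq₁
      have f3 := mul_le_mul_of_nonneg_left h1 habs
      have e : (1 + K₁ + |Real.log K₁| + q₁) * (L : ℝ) ^ (q₁ + 1) =
          (L : ℝ) ^ (q₁ + 1) + K₁ * (L : ℝ) ^ (q₁ + 1) + |Real.log K₁| * (L : ℝ) ^ (q₁ + 1) + q₁ * (L : ℝ) ^ (q₁ + 1) := by ring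
      rw [e]
      linarith
    have hS0 : 0 ≤ 1 + |w| + |Real.log ((K₁ * (L : ℝ) ^ q₁)⁻¹)| + Real.log β := by
      have := abs_nonneg w; have := abs_nonneg (Real.log ((K₁ * (L : ℝ) ^ q₁)⁻¹)); have := Real.log_nonneg hβ1
      linarith
    -- `(9L⁴+2)² ≤ 121 L⁸`
    have hsq : (9 * (L : ℝ) ^ 4 + 2) ^ 2 ≤ 121 * ((L : ℝ) ^ 4 * (L : ℝ) ^ 4) := by
      have hPP : (L : ℝ) ^ 4 ≤ (L : ℝ) ^ 4 * (L : ℝ) ^ 4 := le_mul_of_one_le_right (by positivity) hP1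
      have h11 : (1 : ℝ) ≤ (L : ℝ) ^ 4 * (L : ℝ) ^ 4 := one_le_mul_of_one_le_of_one_le hP1 hP1
      have e : (9 * (L : ℝ) ^ 4 + 2) ^ 2 = 81 * ((L : ℝ) ^ 4 * (L : ℝ) ^ 4) + 36 * (L : ℝ) ^ 4 + 4 := by ring
      rw [e]
      linarith
    -- the two monomials
    have hm1 : (L : ℝ) ^ (2 * q₁ + 9) ≤ β ^ (1 / 2 : ℝ) := hpow _ (by linarith) ha1
    have hm2 : (L : ℝ) ^ (q₁ + 8) * β ^ a ≤ β ^ (1 / 2 : ℝ) := by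
      have h1 : (L : ℝ) ^ (q₁ + 8) ≤ β ^ (a * (q₁ + 8)) := by
        calc (L : ℝ) ^ (q₁ + 8) ≤ (β ^ a) ^ (q₁ + 8) := Real.rpow_le_rpow hℓ0.le hLβ (by linarith)
          _ = β ^ (a * (q₁ + 8)) := by rw [← Real.rpow_mul hβ0.le]
      calc (L : ℝ) ^ (q₁ + 8) * β ^ a ≤ β ^ (a * (q₁ + 8)) * β ^ a :=
            mul_le_mul_of_nonneg_right h1 (Real.rpow_nonneg hβ0.le _)
        _ = β ^ (a * (q₁ + 9)) := by rw [← Real.rpow_add hβ0]; ring_nf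
        _ ≤ β ^ (1 / 2 : ℝ) := Real.rpow_le_rpow_of_exponent_le hβ1 ha2
    -- assemble: LHS·κ ≤ 7744 K₁ L^{q₁+8} · S ≤ C₃ β^{1/2} ≤ β
    have hA : 64 * (9 * (L : ℝ) ^ 4 + 2) ^ 2 * (1 + |w| + |Real.log ((K₁ * (L : ℝ) ^ q₁)⁻¹)| + Real.log β) * (K₁ * (L : ℝ) ^ q₁)
        ≤ 7744 * K₁ * (L : ℝ) ^ (q₁ + 8) * ((1 + K₁ + |Real.log K₁| + q₁) * (L : ℝ) ^ (q₁ + 1) + β ^ a / a) := by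
      rw [hq8]
      have h1 : 64 * (9 * (L : ℝ) ^ 4 + 2) ^ 2 * (K₁ * (L : ℝ) ^ q₁) ≤ 7744 * K₁ * ((L : ℝ) ^ q₁ * ((L : ℝ) ^ 4 * (L : ℝ) ^ 4)) := by
        have h := mul_le_mul_of_nonneg_right hsq hκ0.le
        have e : 7744 * K₁ * ((L : ℝ) ^ q₁ * ((L : ℝ) ^ 4 * (L : ℝ) ^ 4)) = 64 * (121 * ((L : ℝ) ^ 4 * (L : ℝ) ^ 4) * (K₁ * (L : ℝ) ^ q₁)) := by
          ring
        rw [e]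
        linarith
      have h2 : 0 ≤ 7744 * K₁ * ((L : ℝ) ^ q₁ * ((L : ℝ) ^ 4 * (L : ℝ) ^ 4)) := by positivity
      calc 64 * (9 * (L : ℝ) ^ 4 + 2) ^ 2 * (1 + |w| + |Real.log ((K₁ * (L : ℝ) ^ q₁)⁻¹)| + Real.log β) * (K₁ * (L : ℝ) ^ q₁)
          = (64 * (9 * (L : ℝ) ^ 4 + 2) ^ 2 * (K₁ * (L : ℝ) ^ q₁)) *
              (1 + |w| + |Real.log ((K₁ * (L : ℝ) ^ q₁)⁻¹)| + Real.log β) := by ring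
        _ ≤ (7744 * K₁ * ((L : ℝ) ^ q₁ * ((L : ℝ) ^ 4 * (L : ℝ) ^ 4))) *
              ((1 + K₁ + |Real.log K₁| + q₁) * (L : ℝ) ^ (q₁ + 1) + β ^ a / a) :=
            mul_le_mul h1 hS hS0 h2
    have hB : 7744 * K₁ * (L : ℝ) ^ (q₁ + 8) * ((1 + K₁ + |Real.log K₁| + q₁) * (L : ℝ) ^ (q₁ + 1) + β ^ a / a) ≤
        C₃ * β ^ (1 / 2 : ℝ) := by
      have e : 7744 * K₁ * (L : ℝ) ^ (q₁ + 8) * ((1 + K₁ + |Real.log K₁| + q₁) * (L : ℝ) ^ (q₁ + 1) + β ^ a / a) =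
          7744 * K₁ * (1 + K₁ + |Real.log K₁| + q₁) * ((L : ℝ) ^ (q₁ + 8) * (L : ℝ) ^ (q₁ + 1)) +
            7744 * K₁ * (1 / a) * ((L : ℝ) ^ (q₁ + 8) * β ^ a) := by
        field_simp
      rw [e, ← h2q9, hC₃]
      have f1 := mul_le_mul_of_nonneg_left hm1 (by positivity : 0 ≤ 7744 * K₁ * (1 + K₁ + |Real.log K₁| + q₁))
      have f2 := mul_le_mul_of_nonneg_left hm2 (by positivity : 0 ≤ 7744 * K₁ * (1 / a))
      have e : 7744 * K₁ * (1 + K₁ + |Real.log K₁| + q₁ + 1 / a) * β ^ (1 / 2 : ℝ) =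
          7744 * K₁ * (1 + K₁ + |Real.log K₁| + q₁) * β ^ (1 / 2 : ℝ) + 7744 * K₁ * (1 / a) * β ^ (1 / 2 : ℝ) := by ring
      rw [e]
      linarith
    calc 64 * (9 * (L : ℝ) ^ 4 + 2) ^ 2 * (1 + |w| + |Real.log ((K₁ * (L : ℝ) ^ q₁)⁻¹)| + Real.log β) * (K₁ * (L : ℝ) ^ q₁)
        ≤ C₃ * β ^ (1 / 2 : ℝ) := hA.trans hB
      _ ≤ β ^ (1 / 2 : ℝ) * β ^ (1 / 2 : ℝ) := mul_le_mul_of_nonneg_right hHC₃ (by positivity)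
      _ = β := hHH
  exact ⟨hβ2, hthr2, hthr3, div_le_div_of_nonneg_right hpack hβ0.le⟩

end Summit.QuantumFields.YangMills.Theorems.VirialFluxGapSharpTwistedLaplaceWindow

end
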